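import Mathlib.Analysis.SpecialFunctions.Pow.Deriv
import Mathlib.Analysis.Calculus.Deriv.Prod
import Literature.NumberTheory.GaloisRepresentations.ArtinLFunction
import Literature.NumberTheory.LFunctions.EntireContinuationFE
import HarnessLib

/-!
# Artin L-functions: entirety from the functional equation and one-sided continuations
(pure proofs; companion to `Literature.NumberTheory.GaloisRepresentations.ArtinLFunction` and
`Literature.NumberTheory.LFunctions.EntireContinuationFE`)

The archimedean part of Artin's functional equation `Λ(1 - s, ρ) = W(ρ) Λ(s, ρ^∨)`,
`Λ(s, ρ) = A(ρ)^{s/2} γ(ρ, s) L(s, ρ)` (`completedArtinLFunction`,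
`ArtinRep.SatisfiesFunctionalEquation`; Neukirch VII (12.6), Martinet §4 Thm. 4.5) is analysed
just far enough to feed the abstract gluing theorem
`Literature.NumberTheory.LFunctions.exists_entire_eq_of_functionalEquation`:

* `Complex.differentiableAt_Gammaℝ_of_ne_zero`, `differentiableAt_Gammaℂ_of_re_pos` — `Γ_ℝ`
  is holomorphic wherever it is non-zero, since `1/Γ_ℝ` is *entire* (Mathlib
  `Complex.differentiable_Gammaℝ_inv`), in particular on `re s > 0`
  (`Complex.Gammaℝ_ne_zero_of_re_pos`; the tree's `ZetaArgVariation` has the `re s > 0` case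
  by a different route, behind the Riemann-zeta imports, so it is not imported here);
* `ArtinRep.differentiableOn_gammaFactor` — `γ(ρ, s)` is holomorphic on `re s > 0`;
  `ArtinRep.exists_differentiable_mul_gammaFactor_eq_one` — `1/γ(ρ, s)` extends to an entire
  function (a finite product of powers of `1/Γ_ℝ(s)`, `1/Γ_ℝ(s+1)`);
* `ArtinRep.artinConductorNorm_ne_zero'` — the global Artin conductor `∏ᶠ v^{a_v}` is a
  non-zero ideal *unconditionally* (a `finprod` is a finite product of the non-zero ideals
  `v^{a_v}` of the Dedekind domain `𝓞 K`, or its junk value `1`; private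
  `artinConductor_ne_bot_aux`, a copy of `GaloisRep.artinConductor_ne_bot` of
  `Automorphic/LanglandsTunnellLSeriesProofs`, not imported here), so
  `A(ρ) = |d_K|^{dim V} N𝔣(ρ) ≠ 0` and `A(ρ)^{s/2}` is entire and invertible;
* `ArtinRep.hasEntireContinuation_of_satisfiesFunctionalEquation` (**main result, proved**):
  if the Artin representations `ρ`, `ρ'` satisfy Artin's functional equation
  (`ρ.SatisfiesFunctionalEquation ρ'`, with `ρ'` in the role of `ρ^∨`) and both `L(s, ρ)` and
  `L(s, ρ')` admit holomorphic continuations to a half-plane `re s > c` with `0 ≤ c < 1/2`,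
  then `L(s, ρ)` has entire continuation (`LFunction.HasEntireContinuation`).  This is the
  device by which the entirety of `L(s, σ)` follows from the automorphy of `σ` and `σ^∨` at
  almost all places (partial L-functions of cuspidal representations are entire, and the
  finitely many Artin Euler factors removed have their poles on `re s = 0`) without any local
  comparison at the ramified places (Deligne–Serre 1974, proof of Thm. 4.6, plays the two
  functional equations against finitely many local factors in the same way).

No new definitions; nothing restates an existing declaration (`lean search`: the tree has no
differentiability statement for `gammaFactor`/`Gammaℝ`; the unconditional non-vanishing of
`artinConductorNorm` is only available downstream of the modular-forms files).

## References

* J. Neukirch, *Algebraic Number Theory* (1999), VII §12, (12.5)–(12.6). [NeukirchANT1999]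
* J. Martinet, *Character theory and Artin L-functions* (1977), §§3–4, Thm. 4.5.
  [MartinetDurham1977]
* P. Deligne, J.-P. Serre, *Formes modulaires de poids 1*, Ann. Sci. ÉNS (4) 7 (1974), proof of
  Thm. 4.6 and Lemma 4.9. [DeligneSerreASENS1974]
-/

noncomputable section

open scoped NumberField
open Complex Field NumberField Set Filter Topology

/-! ### `Γ_ℝ`, `Γ_ℂ` are holomorphic where they do not vanish -/

namespace Complex

/-- `Γ_ℝ` is complex-differentiable at every point where it does not vanish: its inverse
`1/Γ_ℝ` is entire (Mathlib `Complex.differentiable_Gammaℝ_inv`) and `Γ_ℝ = (1/Γ_ℝ)⁻¹`.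
(Declared in Mathlib's `Complex` namespace as a deliberate dot-notation extension next to
`Complex.Gammaℝ_ne_zero_of_re_pos`.) [folklore] -/
theorem differentiableAt_Gammaℝ_of_ne_zero {s : ℂ} (h : Gammaℝ s ≠ 0) :
    DifferentiableAt ℂ Gammaℝ s := by
  have h1 : (fun z => ((Gammaℝ z)⁻¹)⁻¹) = Gammaℝ := by
    funext z
    rw [inv_inv]
  rw [← h1]
  exact (differentiable_Gammaℝ_inv s).inv (inv_ne_zero h)

/-- `s ↦ Γ_ℝ(s + 1)` is holomorphic on `re s > -1`, in particular on `re s > 0`. [folklore] -/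
theorem differentiableAt_Gammaℝ_add_one_of_re_pos {s : ℂ} (hs : 0 < s.re) :
    DifferentiableAt ℂ (fun z : ℂ => Gammaℝ (z + 1)) s := by
  have h1 : 0 < (s + 1).re := by
    rw [add_re, one_re]
    linarith
  exact (differentiableAt_Gammaℝ_of_ne_zero (Gammaℝ_ne_zero_of_re_pos h1)).comp s
    (differentiableAt_id.add_const 1)

/-- `Γ_ℂ(s) = Γ_ℝ(s) Γ_ℝ(s + 1)` is holomorphic on `re s > 0`. [folklore] -/
theorem differentiableAt_Gammaℂ_of_re_pos {s : ℂ} (hs : 0 < s.re) :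
    DifferentiableAt ℂ Gammaℂ s := by
  have h1 : (fun z : ℂ => Gammaℝ z * Gammaℝ (z + 1)) = Gammaℂ := by
    funext z
    exact Gammaℝ_mul_Gammaℝ_add_one z
  rw [← h1]
  exact (differentiableAt_Gammaℝ_of_ne_zero (Gammaℝ_ne_zero_of_re_pos hs)).mul
    (differentiableAt_Gammaℝ_add_one_of_re_pos hs)

/-- `Γ_ℂ(s) ≠ 0` for `re s > 0`. [folklore] -/
theorem Gammaℂ_ne_zero_of_re_pos {s : ℂ} (hs : 0 < s.re) : Gammaℂ s ≠ 0 := by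
  rw [← Gammaℝ_mul_Gammaℝ_add_one]
  refine mul_ne_zero (Gammaℝ_ne_zero_of_re_pos hs) (Gammaℝ_ne_zero_of_re_pos ?_)
  rw [add_re, one_re]
  linarith

end Complex

namespace Literature.NumberTheory.GaloisRepresentations

universe u w w'

/-! ### The global Artin conductor is a non-zero ideal -/

section Conductor

variable {K : Type u} [Field K] [NumberField K] {A : Type*} [CommRing A] [TopologicalSpace A]
  {M : Type*} [AddCommGroup M] [Module A M] [TopologicalSpace M]

/-- **The global Artin conductor is non-zero**, unconditionally: `𝔣(ρ) = ∏ᶠ_v v^{a_v(ρ)}` is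
either a finite product of the non-zero ideals `v^{a_v}` of the Dedekind domain `𝓞 K` (when
`ρ` is unramified almost everywhere) or the junk value `1 = ⊤` of `finprod`; in neither case is
it `⊥` (Mathlib `finprod_induction`; `Ideal (𝓞 K)` has no zero divisors).  A public copy of
this lemma, `GaloisRep.artinConductor_ne_bot`, lives in
`Automorphic/LanglandsTunnellLSeriesProofs`; it is re-proved privately here so that this
`GaloisRepresentations` file does not import the modular-forms side.
Ref: Serre, *Local Fields*, VI §3. [folklore] -/
private theorem artinConductor_ne_bot_aux (ρ : GaloisRep K A M) : ρ.artinConductor ≠ ⊥ := by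
  unfold GaloisRep.artinConductor
  refine finprod_induction (p := fun I : Ideal (𝓞 K) => I ≠ ⊥) ?_ ?_ ?_
  · exact one_ne_zero
  · intro I J hI hJ
    exact mul_ne_zero hI hJ
  · intro v
    exact pow_ne_zero _ v.ne_bot

end Conductor

namespace ArtinRep

section Archimedean

variable {K : Type u} [Field K] [NumberField K] {V : Type w} [AddCommGroup V] [Module ℂ V]
  [TopologicalSpace V]

/-- **`A(ρ) ≠ 0` unconditionally**: `A(ρ) = |d_K|^{dim V} · N𝔣(ρ)` with `d_K ≠ 0` and
`𝔣(ρ) ≠ ⊥` (`GaloisRep.artinConductor_ne_bot`); the tree's `artinConductorNorm_ne_zero` asks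
for `𝔣(ρ) ≠ ⊥` as a hypothesis, which is discharged here. [folklore] -/
theorem artinConductorNorm_ne_zero' (ρ : ArtinRep K V) : ρ.artinConductorNorm ≠ 0 :=
  ρ.artinConductorNorm_ne_zero (artinConductor_ne_bot_aux ρ)

/-- **The archimedean `Γ`-factor `γ(ρ, s)` is holomorphic on `re s > 0`**: it is a finite
product, over the infinite places `w` of `K`, of `Γ_ℝ(s)^{n⁺_w} Γ_ℝ(s + 1)^{n⁻_w}` (`w` real)
or `Γ_ℂ(s)^{dim V}` (`w` complex), each factor holomorphic on `re s > 0`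
(`Complex.differentiableAt_Gammaℝ_of_ne_zero`, `…_add_one_of_re_pos`, `…Gammaℂ_of_re_pos`).
Ref: Neukirch VII §12, (12.5); Martinet §3. [folklore] -/
theorem differentiableOn_gammaFactor (ρ : ArtinRep K V) :
    DifferentiableOn ℂ ρ.gammaFactor {s : ℂ | 0 < s.re} := by
  classical
  intro s hs
  refine DifferentiableAt.differentiableWithinAt ?_
  unfold gammaFactor
  refine DifferentiableAt.fun_finsetProd fun w _ => ?_
  by_cases hw : w.IsReal
  · simp only [hw, ↓reduceDIte]
    exact ((differentiableAt_Gammaℝ_of_ne_zero (Gammaℝ_ne_zero_of_re_pos hs)).pow _).mul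
      ((differentiableAt_Gammaℝ_add_one_of_re_pos hs).pow _)
  · simp only [hw, ↓reduceDIte]
    exact (differentiableAt_Gammaℂ_of_re_pos hs).pow _

/-- **`1/γ(ρ, s)` extends to an entire function**: there is an entire `γinv` with
`γ(ρ, s) · γinv(s) = 1` for `re s > 0`, namely the corresponding finite product of powers of
the entire functions `1/Γ_ℝ(s)`, `1/Γ_ℝ(s + 1)` (Mathlib `Complex.differentiable_Gammaℝ_inv`;
`1/Γ_ℂ(s) = 1/Γ_ℝ(s) · 1/Γ_ℝ(s + 1)`), which invert the factors of `γ(ρ, s)` wherever these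
are non-zero, in particular on `re s > 0`.  Ref: Neukirch VII §12, (12.5). [folklore] -/
theorem exists_differentiable_mul_gammaFactor_eq_one (ρ : ArtinRep K V) :
    ∃ γinv : ℂ → ℂ, Differentiable ℂ γinv ∧ ∀ s : ℂ, 0 < s.re → ρ.gammaFactor s * γinv s = 1 := by
  classical
  -- the inverse factors
  let ginv : InfinitePlace K → ℂ → ℂ := fun w s =>
    if hw : w.IsReal then
      (Gammaℝ s)⁻¹ ^ (ρ.signature (InfinitePlace.embedding_of_isReal hw)).1 *
        (Gammaℝ (s + 1))⁻¹ ^ (ρ.signature (InfinitePlace.embedding_of_isReal hw)).2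
    else ((Gammaℝ s)⁻¹ * (Gammaℝ (s + 1))⁻¹) ^ Module.finrank ℂ V
  have hinv1 : Differentiable ℂ fun s : ℂ => (Gammaℝ (s + 1))⁻¹ :=
    differentiable_Gammaℝ_inv.comp (differentiable_id.add_const 1)
  have hginv : ∀ w, Differentiable ℂ (ginv w) := by
    intro w
    by_cases hw : w.IsReal
    · simp only [ginv, hw, ↓reduceDIte]
      exact (differentiable_Gammaℝ_inv.pow _).mul (hinv1.pow _)
    · simp only [ginv, hw, ↓reduceDIte]
      exact (differentiable_Gammaℝ_inv.mul hinv1).pow _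
  refine ⟨fun s => ∏ w : InfinitePlace K, ginv w s, ?_, fun s hs => ?_⟩
  · exact Differentiable.fun_finsetProd fun w _ => hginv w
  · have h0 : Gammaℝ s ≠ 0 := Gammaℝ_ne_zero_of_re_pos hs
    have h1 : Gammaℝ (s + 1) ≠ 0 := Gammaℝ_ne_zero_of_re_pos (by rw [add_re, one_re]; linarith)
    unfold gammaFactor
    rw [← Finset.prod_mul_distrib]
    refine Finset.prod_eq_one fun w _ => ?_
    by_cases hw : w.IsReal
    · simp only [ginv, hw, ↓reduceDIte]
      rw [mul_mul_mul_comm, ← mul_pow, ← mul_pow, mul_inv_cancel₀ h0, mul_inv_cancel₀ h1,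
        one_pow, one_pow, one_mul]
    · simp only [ginv, hw, ↓reduceDIte]
      rw [← mul_pow, ← Gammaℝ_mul_Gammaℝ_add_one, mul_mul_mul_comm, mul_inv_cancel₀ h0,
        mul_inv_cancel₀ h1, one_mul, one_pow]

/-- **The full factor `A(ρ)^{s/2} γ(ρ, s)` of the completed L-function**: holomorphic on
`re s > 0`, with an entire inverse there (`A(ρ) ≠ 0` by `artinConductorNorm_ne_zero'`, so
`A(ρ)^{s/2}` is entire and non-vanishing). [folklore] -/
theorem exists_differentiable_mul_completedFactor_eq_one (ρ : ArtinRep K V) :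
    DifferentiableOn ℂ (fun s : ℂ => (ρ.artinConductorNorm : ℂ) ^ (s / 2) * ρ.gammaFactor s)
        {s : ℂ | 0 < s.re} ∧
      ∃ γinv : ℂ → ℂ, Differentiable ℂ γinv ∧ ∀ s : ℂ, 0 < s.re →
        (ρ.artinConductorNorm : ℂ) ^ (s / 2) * ρ.gammaFactor s * γinv s = 1 := by
  have hA : (ρ.artinConductorNorm : ℂ) ≠ 0 := Nat.cast_ne_zero.2 ρ.artinConductorNorm_ne_zero'
  have hpow : Differentiable ℂ fun s : ℂ => (ρ.artinConductorNorm : ℂ) ^ (s / 2) := fun s =>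
    DifferentiableAt.const_cpow (differentiableAt_id.div_const 2) (Or.inl hA)
  have hpow0 : ∀ s : ℂ, (ρ.artinConductorNorm : ℂ) ^ (s / 2) ≠ 0 := fun s h =>
    hA ((cpow_eq_zero_iff _ _).1 h).1
  obtain ⟨γinv, hγinv, hγ⟩ := ρ.exists_differentiable_mul_gammaFactor_eq_one
  refine ⟨hpow.differentiableOn.mul ρ.differentiableOn_gammaFactor,
    fun s => ((ρ.artinConductorNorm : ℂ) ^ (s / 2))⁻¹ * γinv s, ?_, fun s hs => ?_⟩
  · exact (hpow.inv hpow0).mul hγinv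
  · calc (ρ.artinConductorNorm : ℂ) ^ (s / 2) * ρ.gammaFactor s *
          (((ρ.artinConductorNorm : ℂ) ^ (s / 2))⁻¹ * γinv s)
          = ((ρ.artinConductorNorm : ℂ) ^ (s / 2) * ((ρ.artinConductorNorm : ℂ) ^ (s / 2))⁻¹) *
              (ρ.gammaFactor s * γinv s) := by ring
      _ = 1 := by rw [mul_inv_cancel₀ (hpow0 s), hγ s hs, one_mul]

end Archimedean

/-! ### Entirety from the functional equation and one-sided continuations -/

section FunctionalEquation

variable {K : Type u} [Field K] [NumberField K] {V : Type w} [AddCommGroup V] [Module ℂ V]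
  [TopologicalSpace V] [FiniteDimensional ℂ V] {V' : Type w'} [AddCommGroup V'] [Module ℂ V']
  [TopologicalSpace V'] [FiniteDimensional ℂ V']

/-- **Entirety of an Artin L-function from Artin's functional equation and one-sided
continuations.**  Let the Artin representations `ρ`, `ρ'` of the number field `K` satisfy
Artin's functional equation (`ρ.SatisfiesFunctionalEquation ρ'`: meromorphic `Λ`, `Λ'` on `ℂ`
continuing `Λ(s, ρ) = A^{s/2} γ(ρ, s) L(s, ρ)` and `Λ(s, ρ')` from `re s > 1`, with
`Λ(1 - s) = W Λ'(s)`; Neukirch VII (12.6) with `ρ' = ρ^∨`), and suppose that `L(s, ρ)` and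
`L(s, ρ')` both admit holomorphic continuations to the half-plane `re s > c` for some
`0 ≤ c < 1/2`.  Then `L(s, ρ)` has entire continuation.  Proof:
`Literature.NumberTheory.LFunctions.exists_entire_eq_of_functionalEquation` with
`γ = A(ρ)^{s/2} γ(ρ, s)`, `γ' = A(ρ')^{s/2} γ(ρ', s)` (holomorphic on `re s > 0 ≥ c`, the former
with an entire inverse, `exists_differentiable_mul_completedFactor_eq_one`).
[cite: NeukirchANT1999, VII §12, Thm. (12.6)] [cite: DeligneSerreASENS1974, proof of Thm. 4.6] -/
theorem hasEntireContinuation_of_satisfiesFunctionalEquation {ρ : ArtinRep K V}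
    {ρ' : ArtinRep K V'} (hFE : ρ.SatisfiesFunctionalEquation ρ') {c : ℝ} (hc0 : 0 ≤ c)
    (hc : c < 1 / 2)
    (hE : ∃ E : ℂ → ℂ, DifferentiableOn ℂ E {s : ℂ | c < s.re} ∧
      ∀ s : ℂ, 1 < s.re → E s = artinLFunction ρ s)
    (hE' : ∃ E' : ℂ → ℂ, DifferentiableOn ℂ E' {s : ℂ | c < s.re} ∧
      ∀ s : ℂ, 1 < s.re → E' s = artinLFunction ρ' s) :
    LFunction.HasEntireContinuation (artinLFunction ρ) := by
  obtain ⟨E, hE, hEL⟩ := hE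
  obtain ⟨E', hE', hE'L'⟩ := hE'
  obtain ⟨Λ, Λ', hΛ, hΛ', hagree, W, -, hW⟩ := hFE
  obtain ⟨hγ, γinv, hγinv, hγγ⟩ := ρ.exists_differentiable_mul_completedFactor_eq_one
  have hγ' := (ρ'.exists_differentiable_mul_completedFactor_eq_one).1
  have hsub : {s : ℂ | c < s.re} ⊆ {s : ℂ | 0 < s.re} := fun s hs => hc0.trans_lt hs
  exact Literature.NumberTheory.LFunctions.exists_entire_eq_of_functionalEquation hc hE hEL hE'
    hE'L' (hγ.mono hsub) (hγ'.mono hsub) hγinv (fun s hs => hγγ s (hc0.trans_lt hs))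
    (hΛ.meromorphicOn) (hΛ'.meromorphicOn) (fun s hs => (hagree s hs).1)
    (fun s hs => (hagree s hs).2) hW

end FunctionalEquation

end ArtinRep

end Literature.NumberTheory.GaloisRepresentations

end
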